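import Summits.Ventures.PercRepro.Night2StarMixedB
import Summits.Ventures.PercRepro.Night2StarTriangle

/-!
# PercRepro — night-2: `(★)` at every basis of corank `≥ 22`, and the type-`2` balance on every rank-`q` set with `≥ q + 22`
points (blind cell pub-perc-repro, night-2 gen 1; sharpens `Night2StarLarge`'s threshold `31` with `Night2StarMixedB`)

Split the outside points `G ∖ B` of a basis `B` into the NON-TRIANGLE points `N` (`m(B ∪ {x}) + 3 ≤ q`: fundamental circuits of
`≥ 4` points) and the TRIANGLE points `T` (`m(B ∪ {x}) + 2 = q`). With `|G ∖ B| ≥ 22`: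
* `|N| ≥ 8`: the singles pay (`rec_ge_of_eight_nontriangle`);
* `N = ∅`: an all-triangle basis of corank `≥ 19` (`rec_ge_of_all_triangle`: pure line or `≥ 18` cross pairs);
* `1 ≤ |N| ≤ 7`: the `|N|` singles and the `|T|·|N|` mixed pairs pay `|N|/4 + |T||N|/12 = |N|(|T| + 3)/12 ≥ 2` as soon as `|T| + 3 ≥ 24/|N|`,
  i.e. for `d = |N| + |T| ≥ 22` (`rec_ge_of_nontriangle_and_mixed`).
* **`rec_ge_of_corank_ge22`**, **`starCharge_of_corank_ge22`**, **`Jq_two_nonneg_of_corank_ge22`** — `0 ≤ Jq M G q 2` on every rank-`q`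
  set `G` of a simple matroid with `|G| ≥ q + 22`, every `q ≥ 2`.
So the kernel residue of `(★)` (Theorem 12 of `proofs/NIGHT-2-star.md`) is the finite range of coranks `3 ≤ d ≤ 21`.
-/

namespace PercRepro.Star

open Finset ThmH SixFour GenQ

variable {α : Type*} [DecidableEq α] {M : Matroid α} [M.Finite]

/-- Every outside point is a triangle point or a non-triangle point. -/
theorem triangle_or_nontriangle' (hs : Simple M) {G B : Finset α} {q : ℕ} (hG : G ⊆ gr M)
    (hrG : M.eRk (G : Set α) = (q : ℕ∞)) (hB : B ∈ Bq M G q) (hq : 1 ≤ q) {x : α} (hx : x ∈ G \ B)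
    (hnt : ¬ (mTr M (insert x B) + 3 ≤ q)) : mTr M (insert x B) + 2 = q := by
  obtain ⟨hSx, hcx⟩ := insert_mem_SNq hrG hB hx
  have := mTr_add_two_le_of_spanning_nonbasis hs ((mem_SNq.1 hSx).1.trans hG) (mem_SNq.1 hSx).2.1 hq (by omega)
  omega

/-- **`(★)` at every basis of corank `≥ 22`.** -/
theorem rec_ge_of_corank_ge22 (hs : Simple M) {G B : Finset α} {q : ℕ} (hG : G ⊆ gr M)
    (hrG : M.eRk (G : Set α) = (q : ℕ∞)) (hB : B ∈ Bq M G q) (hq : 2 ≤ q) (hd : 22 ≤ (G \ B).card) :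
    2 / ((q : ℚ) + 1) ≤ rec M G q B := by
  set N := (G \ B).filter (fun x => mTr M (insert x B) + 3 ≤ q) with hN
  set T := (G \ B).filter (fun x => ¬ (mTr M (insert x B) + 3 ≤ q)) with hT
  have hNT : N.card + T.card = (G \ B).card :=
    Finset.card_filter_add_card_filter_not (fun x => mTr M (insert x B) + 3 ≤ q)
  have htriT : ∀ x ∈ T, mTr M (insert x B) + 2 = q := fun x hx =>
    triangle_or_nontriangle' hs hG hrG hB (by omega) (Finset.mem_filter.1 hx).1 (Finset.mem_filter.1 hx).2
  rcases Nat.lt_or_ge N.card 8 with hN8 | hN8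
  · rcases Nat.eq_zero_or_pos N.card with hN0 | hNpos
    · -- all triangles
      apply rec_ge_of_all_triangle hs hG hrG hB hq _ (by omega)
      intro x hx
      have hxT : x ∈ T := by
        rw [hT, Finset.mem_filter]
        refine ⟨hx, fun h => ?_⟩
        have : x ∈ N := Finset.mem_filter.2 ⟨hx, h⟩
        rw [Finset.card_eq_zero.1 hN0] at this
        exact Finset.notMem_empty x this
      exact htriT x hxT
    · -- `1 ≤ |N| ≤ 7`: the singles of `N` and the mixed pairs `T × N`
      have hT15 : 15 ≤ T.card := by omega
      have hdisj : ∀ z, z ∈ T → z ∈ N → False := fun z hz hz' =>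
        (Finset.mem_filter.1 hz).2 (Finset.mem_filter.1 hz').2
      set P : Finset (Finset α) := (T ×ˢ N).image (fun p : α × α => ({p.1, p.2} : Finset α)) with hP
      have hinj : Set.InjOn (fun p : α × α => ({p.1, p.2} : Finset α)) ((T ×ˢ N : Finset (α × α)) : Set (α × α)) := by
        intro p hp p' hp' heq
        rw [Finset.mem_coe, Finset.mem_product] at hp hp'
        simp only at heq
        have h1 : p.1 ∈ ({p'.1, p'.2} : Finset α) := by rw [← heq]; simp
        have h2 : p.2 ∈ ({p'.1, p'.2} : Finset α) := by rw [← heq]; simp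
        simp only [Finset.mem_insert, Finset.mem_singleton] at h1 h2
        rcases h1 with h1 | h1
        · rcases h2 with h2 | h2
          · exact absurd (h2 ▸ hp.2) (fun h => hdisj p'.1 hp'.1 h)
          · exact Prod.ext h1 h2
        · exact absurd (h1 ▸ hp.1) (fun h => hdisj p'.2 h hp'.2)
      have hPcard : P.card = T.card * N.card := by
        rw [hP, Finset.card_image_of_injOn hinj, Finset.card_product]
      have hPsub : P ⊆ (G \ B).powersetCard 2 := by
        intro p hp
        rw [hP, Finset.mem_image] at hp
        obtain ⟨⟨u, v⟩, huv, rfl⟩ := hp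
        rw [Finset.mem_product] at huv
        have huD := (Finset.mem_filter.1 huv.1).1
        have hvD := (Finset.mem_filter.1 huv.2).1
        have hne : u ≠ v := fun h => hdisj u huv.1 (h ▸ huv.2)
        rw [Finset.mem_powersetCard]
        refine ⟨?_, Finset.card_pair hne⟩
        intro z hz
        rw [Finset.mem_insert, Finset.mem_singleton] at hz
        rcases hz with rfl | rfl
        · exact huD
        · exact hvD
      have hmix : ∀ p ∈ P, ∃ x y, x ≠ y ∧ p = {x, y} ∧ mTr M (insert x B) + 2 = q ∧ mTr M (insert y B) + 3 ≤ q := by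
        intro p hp
        rw [hP, Finset.mem_image] at hp
        obtain ⟨⟨u, v⟩, huv, rfl⟩ := hp
        rw [Finset.mem_product] at huv
        have hne : u ≠ v := fun h => hdisj u huv.1 (h ▸ huv.2)
        exact ⟨u, v, hne, rfl, htriT u huv.1, (Finset.mem_filter.1 huv.2).2⟩
      have h := rec_ge_of_nontriangle_and_mixed hs hG hrG hB (by omega) (Finset.filter_subset _ _)
        (fun x hx => (Finset.mem_filter.1 hx).2) hPsub hmix
      rw [hPcard] at h
      have hq1 : (0 : ℚ) < (q : ℚ) + 1 := by positivity
      -- `|N|/4 + |T||N|/12 ≥ 2` since `|N|(|T| + 3) ≥ 24`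
      have hN1' : (1 : ℚ) ≤ N.card := by exact_mod_cast hNpos
      have hN7 : (N.card : ℚ) ≤ 7 := by exact_mod_cast (by omega : N.card ≤ 7)
      have hsum : (22 : ℚ) ≤ N.card + T.card := by exact_mod_cast (by omega : 22 ≤ N.card + T.card)
      have hkey : (2 : ℚ) / ((q : ℚ) + 1) ≤ (N.card : ℚ) * (1 / (4 * ((q : ℚ) + 1))) +
          ((T.card * N.card : ℕ) : ℚ) * (1 / (12 * ((q : ℚ) + 1))) := by
        push_cast
        have e : (N.card : ℚ) * (1 / (4 * ((q : ℚ) + 1))) + (T.card : ℚ) * (N.card : ℚ) * (1 / (12 * ((q : ℚ) + 1))) =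
            ((N.card : ℚ) * ((T.card : ℚ) + 3)) / (12 * ((q : ℚ) + 1)) := by
          field_simp
          ring
        rw [e, div_le_div_iff₀ hq1 (by positivity)]
        have hN0 : (0 : ℚ) ≤ N.card := by positivity
        have hNT24 : (24 : ℚ) ≤ (N.card : ℚ) * ((T.card : ℚ) + 3) := by
          nlinarith [mul_nonneg hN0 (sub_nonneg.2 hsum), mul_nonneg (sub_nonneg.2 hN1') (sub_nonneg.2 hN7)]
        nlinarith [mul_le_mul_of_nonneg_right hNT24 hq1.le]
      linarith
  · -- eight non-triangle points
    exact rec_ge_of_eight_nontriangle hs hG hrG hB (by omega) (Finset.filter_subset _ _)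
      (fun x hx => (Finset.mem_filter.1 hx).2) hN8

/-- `(★)` on every rank-`q` set with `≥ q + 22` points. -/
theorem starCharge_of_corank_ge22 (hs : Simple M) {G : Finset α} {q : ℕ} (hG : G ⊆ gr M)
    (hrG : M.eRk (G : Set α) = (q : ℕ∞)) (hq : 2 ≤ q) (hcard : q + 22 ≤ G.card) : StarCharge M G q := by
  intro B hB _
  apply rec_ge_of_corank_ge22 hs hG hrG hB hq
  rw [Finset.card_sdiff_of_subset (mem_Bq.1 hB).1, (mem_Bq.1 hB).2.2]
  omega

/-- **The type-`2` balance on every rank-`q` set with `≥ q + 22` points of a simple matroid, every `q ≥ 2`.** -/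
theorem Jq_two_nonneg_of_corank_ge22 (hs : Simple M) {G : Finset α} {q : ℕ} (hG : G ⊆ gr M)
    (hrG : M.eRk (G : Set α) = (q : ℕ∞)) (hq : 2 ≤ q) (hcard : q + 22 ≤ G.card) : 0 ≤ Jq M G q 2 :=
  Jq_two_nonneg_of_star hs hG hrG (starCharge_of_corank_ge22 hs hG hrG hq hcard)

end PercRepro.Star
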